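import Summits.QuantumAdvantage.QuantumAdvantage.Theorems.RankDialK2
import Summits.QuantumAdvantage.QuantumAdvantage.Theorems.RankDialJ1
import HarnessLib

/-!
# RankDial (L) — node «BlockDial»: §28 the size-free class-bias conjecture `WindowClassBias`; §29 WINDOWS WITH INSIDE CUTS —
# the block dial `SepBlock · η`, pieces `BlockPiece p η ∧ ClusteredPiece p η ⟺ R5`, `η = 1` = the g26 residual; §30 the junta-rank
# layer beneath `BlockPiece` and the frame `closes_block`; §31 MULTI-LIVENESS (the 2/3 law for class labels with cluster coordinates:
# the kernel mechanism for blocks with inside cuts, theorem `multiLiveness`)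

TARGET BY NAME (cell decomp-qadv, RESIDUAL MODE): item stmt-QuantumAdvantage-23109
`Summit.QuantumAdvantage.QuantumAdvantage.Theses.OddPrimeWalk.ManyReadersSqrtOdd`, through rung R5 = `AdviceFreeQNC0.WalkHardFLinSel p`
(`T → ∀ p ≥ 5, R5 p` is in tree: `r5Odd_of_target`).  This file SUPPORTS the item (`--supports`); it does not close it.

PART L (decomp-qadv lens-1 «grading / quantitative ladder», generation 27).  State of the ladder after part K (g26): R5 at `p ≥ 5` ⟸
`WindowJSpreadLinSel p s` (cut-free windows of length `≥ C·log n` whose wide cuts have junta-rank `> ℓ/E`: IDEA-NEEDED, interface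
`SpreadClassBias p s`) ∧ `NoWindowLinSel p` (no long cut-free window at all: the dense core, untouched since g24).

§28 THE SIZE AXIS OF THE WINDOW HALF CARRIES NO NEW RUNG (recorded, with the typed conjecture).  Grading the window residual by the
NUMBER `K` of wide cuts instead of their rank changes nothing: every character / uniformity argument in print (Viola–Wigderson, the
tree's parts C/H/I/K, and the "sublinear number of MOD_m gates" theorem of Chattopadhyay–Goyal–Pudlák–Thérien 2006 = Chattopadhyay's
thesis §3.2, Linear Uniformity Lemma) pays `m^{K}` boolean-solution types against a `γ^ℓ` decay, so it stops at `K ≍ ℓ/p²` — BELOW the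
rank dial (rank ≤ count).  The two-prime depth-2 bounds that DO reach polynomial / exponential size (Krause–Pudlák 1997 Thm 5,
Barrington–Straubing–Thérien 1990, Grolmusz 2001 Thm 11, Barrington–Straubing 1999, Straubing–Thérien 2006) are EXACT: they read the
circuit on a structured set `{u} × V` of measure zero and do not survive a `δ·2^ℓ` error set; the AND-top analogue (boolean solution sets
of linear systems, any number of equations, vs MOD_q) is SOLVED (Chattopadhyay–Wigderson 2009 / Chattopadhyay–Lovett 2011: high rank ⇒
tiny solution set) but a PARITY top gate has no such dichotomy.  So the window half's residual is exactly an average-case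
MOD₂∘MOD_p-versus-MOD₃ bound at polynomial size with a CONSTANT threshold; we type its cleanest form `WindowClassBias p` (no width
parameter: every long cut-free window, every outside fibre, every live class: class sum `≤ 2^ℓ/8`) and prove
`WindowClassBias p → SpreadClassBias p s → … → R5` (`spreadClassBias_of_window`, `r5_of_windowClassBias`).  [UNDECIDED · STRONGER than
the interface it feeds · cheapest falsifier = a kit search, asked of the census.]

§29 THE NEW AXIS: WINDOWS WITH INSIDE CUTS (the block dial).  A window of the tree must be cut-FREE; the dense core is everything else.
Part L interpolates: `SepBlock y a m η` says the live cuts strictly inside the block `[a, a+m)` are pairwise, and from the two ends,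
`≥ m/η` apart (so there are `< η` of them); `η = 1` is LITERALLY `CutFree` (`sepBlock_one_iff`), `η = 0` is every block.  Pieces:
`BlockPiece p η` (every `η`-separated block of length `≥ C·(log₂ n + 1)` gives `#WIN ≤ θ·2ⁿ`) and `ClusteredPiece p η` (a strategy with
NO such block wins on `≤ θ·2ⁿ`, one `θ` for all `C`); `r5_iff_block_pieces : R5 ⟺ BlockPiece p η ∧ ClusteredPiece p η` for EVERY `η`
(`r5_of_block_pieces` is the case split of `r5_of_rank_pieces` with `SepBlock` for `CutFree`; necessity is trivial).  Monotonicity: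
`BlockPiece` is ANTITONE and `ClusteredPiece` MONOTONE in `η ≥ 1` (`blockPiece_anti`, `clusteredPiece_mono`): turning the dial moves
strategies from the combinatorial core into the analytic piece.  RECOVERY AT `η = 1`: `BlockPiece p 1 ↔ WindowPiece p ↔
WindowHighRankLinSel p` (`p ≥ 5`) and `ClusteredPiece p 1 ↔ NoWindowLinSel p` — the g26 residual is the first notch of the dial
(`residual_one_iff`).

§30 THE JUNTA-RANK LAYER BENEATH `BlockPiece` and the frame.  `BlockJSpan p η` (separated blocks of junta-rank `D` with the perturb budget
`(p·D+2)·M ≤ ℓ`; `η = 1`: PROVED = `WindowJSpanLinSel`, `blockJSpan_one_holds`; `η ≥ 2`: ATTACKABLE by §31 + parts C–K) and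
`BlockJSpread p η s` (separated blocks of junta-rank `> ℓ/E`: IDEA-NEEDED, the §28 open problem for blocks) give `BlockPiece p η`
(`blockPiece_of_jspan_jspread`, the budget bookkeeping of `highRank_of_jspan_jspread`).  Frame: `r5_residual_block :
BlockJSpan p η → BlockJSpread p η s → ClusteredPiece p η → WalkHardFLinSel p`; at `η = 1` this IS `r5_residual_jspread`
(`r5_residual_block_one`, `residual_one_iff`); `closes_block` / `target_iff_block` reach the target BY NAME through the declared
residual `R5LiftOdd` exactly as `closes` (part C) does.

§31 WHY BLOCKS WITH INSIDE CUTS ARE BOUNDABLE AT ALL — MULTI-LIVENESS (kernel theorem `multiLiveness`, no prime, no window).  On an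
outside fibre of a block, condition also on the bits inside each CLUSTER of inside cuts; the class label of a block input `v` is then
`z = (z₀; w₁…w_J) ∈ ℤ₃ × ℤ₃^J` (`z₀ = |v| mod 3`, `w_j` = the prefix weight at the `j`-th cluster), a cut outside the block is dead iff
`z₀ = k_g`, a cut of cluster `j` is dead iff `z₀ + w_j = k_g`, and `v` wins iff the number of PASSING tests that are dead at `z(v)` has
the parity of `#passing + 1`.  `multiLiveness`: for ANY finite family of such cuts, at most two thirds of the `3^{J+1}` labels have that
parity (`J = 0` is the tree's two-liveness `not_three_odd`).  Proof = the 3-shift lemma `card_filter_le_two_thirds` (a fixed-point-free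
shift `σ` of order 3 with never all of `z, σz, σ²z` bad) applied to the shift of a cluster coordinate whose dead-count parity is not
constant, or else to the shift of `z₀`.  This is the counting half of every future block law; the analytic half (class sums against the
characters `ω^{a₀|v| + Σ a_j |v_{<h_j}|}`, whose supports are unions of gaps, hence `≥ m/η` on a separated block) is the window machinery
of parts C–K verbatim — which is why the dial is cut at gaps `∝ m` (the `p^D` level-set cost of a rank-`D` block must be repaid by the
decay of EVERY character, including one supported on a single gap).

TAGS.  `WindowClassBias` UNDECIDED/STRONGER-than-interface; `BlockPiece p η`, `ClusteredPiece p η`, `BlockJSpan p η`, `BlockJSpread p η s`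
all NECESSARY (implied by R5: `blockPiece_of_r5`, `clusteredPiece_of_r5`, `blockJSpan_of_r5`, `blockJSpread_of_r5`) hence WEAKER-or-equal;
`BlockJSpan p 1` PROVED (`p ≠ 3`); `BlockJSpan p η`, `η ≥ 2` ATTACKABLE (mechanism §31, plan in the node memo); `BlockJSpread p η s`
IDEA-NEEDED (average-case two-prime depth-2, §28); `ClusteredPiece p η` IDEA-NEEDED (the clustered core: strategies all of whose long blocks
contain two live cuts closer than `m/η` or one closer than `m/η` to where one would cut the block; `η = 1` = the dense core).  No piece is
a COSTUME: none mentions the summit, the target or a refuted statement, and the frame is an `↔` (`r5_iff_block_pieces`).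
WHY NOVEL (one sentence): the window method of parts A–K needed cut-FREE windows; part L shows the method's counting half survives
inside cuts (`multiLiveness`) and types the resulting one-parameter trade between the analytic piece and the combinatorial core, with the
old residual as notch `η = 1`.
Farm `lean check` rc 0 · 0 sorry · no `native_decide` / `instance` / notation; axioms {propext, Classical.choice, Quot.sound}.
-/

set_option linter.dupNamespace false
set_option autoImplicit false

noncomputable section
open Classical

namespace Summit.QuantumAdvantage.QuantumAdvantage.Theorems.RankDial

open Finset
open Summit.QuantumAdvantage.AdviceFreeQNC0
open Literature.Computability.MetaComplexity Literature.Computability.MetaComplexity.Smolensky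

/-! ### §28 (part L «BlockDial») The size-free class-bias conjecture of the window half -/

section ClassBiasConj
variable (p : ℕ) [Fact p.Prime]

/-- **CONJECTURE `WindowClassBias p`** (the window half's residual in its cleanest form; no width parameter, no rank hypothesis): there
are `C, n₀` such that for every linear-test strategy on `n ≥ n₀` bits, every cut-free window of length `ℓ ≥ C·(log₂ n + 1)`, every
outside fibre `(a, b)` and every class `r`, the live-class sum `Σ_v (−1)^{classPar_r(v)} ω^{|v|}` has norm `≤ 2^ℓ / 8`.  In words: a
parity of at most `n + 1 ≤ 2^{ℓ/C}` affine MOD_p tests of `ℓ` bits has correlation `≤ 1/8` with each MOD₃ character of the weight —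
an AVERAGE-CASE depth-2 two-prime statement at polynomial size with a CONSTANT threshold (§28 of the header: every bound in print is
either exact or capped at `≍ ℓ/p²` tests).  [UNDECIDED · STRONGER than `SpreadClassBias p s` for every `s` (`spreadClassBias_of_window`)
· in the span regime the sums are `≤ 2^ℓ/4` (`classBias_of_wrank`, part J) · cheapest falsifier: `p = 5`, `ℓ = 12…16`, random dense
forms, greedy search for `max_r |class sum| / 2^ℓ > 1/8` (asked of the census instrument).] -/
def WindowClassBias : Prop :=
  ∃ C : ℕ, ∃ n₀ : ℕ, ∀ L ℓ R : ℕ, n₀ ≤ L + ℓ + R → C * (Nat.log 2 (L + ℓ + R) + 1) ≤ ℓ →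
    ∀ (c : ℕ) (y : Fin (L + ℓ + R + 1) → (Fin (L + ℓ + R) → Bool) → Bool), LinSel p y → CutFree y L ℓ →
      ∀ (a : Fin L → Bool) (b : Fin R → Bool) (r : ℕ),
        ‖∑ v : Fin ℓ → Bool, GowersCube.signChar (classPar c y a b r v) * omega3 ^ wt v‖ ≤ (2 : ℝ) ^ ℓ / 8

/-- `WindowClassBias p ⟹ SpreadClassBias p s` for every width `s` (drop the rank hypothesis). -/
theorem spreadClassBias_of_window (s : ℕ) (h : WindowClassBias p) : SpreadClassBias p s := by
  obtain ⟨C, n₀, h⟩ := h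
  exact fun E _ => ⟨C, n₀, fun L ℓ R hn hC c y lam rr hyl hgap _ a b r =>
    h L ℓ R hn hC c y (fun g => ⟨lam g, rr g, hyl g⟩) hgap a b r⟩

/-- **R5 from the size-free class-bias conjecture and the dense core** (`p ≥ 5`). -/
theorem r5_of_windowClassBias (hp : 5 ≤ p) (hB : WindowClassBias p) (hN : NoWindowLinSel p) : WalkHardFLinSel p :=
  r5_of_classBias p hp 0 (spreadClassBias_of_window p 0 hB) hN

end ClassBiasConj

/-! ### §29 (part L «BlockDial») Windows WITH inside cuts: `SepBlock`, the pieces, `R5 ⟺ BlockPiece ∧ ClusteredPiece`, monotonicity, `η = 1` -/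

section BlockVocab
variable {n : ℕ}

/-- A cut is LIVE if it fires on some input. -/
def Live (y : Fin (n + 1) → (Fin n → Bool) → Bool) (g : Fin (n + 1)) : Prop := ∃ u, y g u = true

/-- **`SepBlock y a m η`** — the block of bit positions `[a, a+m)` is `η`-SEPARATED: every live cut STRICTLY inside it (positions
`a < g < a + m`) is at distance `≥ m/η` from both ends, and any two of them are `≥ m/η` apart.  (`η = 1`: no inside live cut at all =
`CutFree`, `sepBlock_one_iff`; `η = 0`: every block, `sepBlock_zero`; fewer than `η` inside live cuts when `η ≥ 1`.) -/
def SepBlock (y : Fin (n + 1) → (Fin n → Bool) → Bool) (a m η : ℕ) : Prop :=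
  (∀ g : Fin (n + 1), a < g.val → g.val < a + m → Live y g → a + m / η ≤ g.val ∧ g.val + m / η ≤ a + m) ∧
  (∀ g h : Fin (n + 1), a < g.val → h.val < a + m → g.val < h.val → Live y g → Live y h → g.val + m / η ≤ h.val)

/-- A cut-free block is `η`-separated for every `η`. -/
theorem sepBlock_of_cutFree (y : Fin (n + 1) → (Fin n → Bool) → Bool) {a m : ℕ} (h : CutFree y a m) (η : ℕ) :
    SepBlock y a m η := by
  refine ⟨fun g h1 h2 hl => ?_, fun g k h1 h2 h3 hl _ => ?_⟩
  · obtain ⟨u, hu⟩ := hl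
    rw [h g h1 h2 u] at hu
    exact absurd hu Bool.false_ne_true
  · obtain ⟨u, hu⟩ := hl
    rw [h g h1 (by omega) u] at hu
    exact absurd hu Bool.false_ne_true

/-- **`η = 1` is the cut-free window**: `SepBlock y a m 1 ↔ CutFree y a m`. -/
theorem sepBlock_one_iff (y : Fin (n + 1) → (Fin n → Bool) → Bool) (a m : ℕ) : SepBlock y a m 1 ↔ CutFree y a m := by
  refine ⟨fun h g h1 h2 u => ?_, fun h => sepBlock_of_cutFree y h 1⟩
  cases hu : y g u
  · rfl
  · have h3 := (h.1 g h1 h2 ⟨u, hu⟩).1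
    rw [Nat.div_one] at h3
    omega

/-- `η = 0` is every block. -/
theorem sepBlock_zero (y : Fin (n + 1) → (Fin n → Bool) → Bool) (a m : ℕ) : SepBlock y a m 0 := by
  refine ⟨fun g h1 h2 _ => ?_, fun g k _ _ h3 _ _ => ?_⟩
  · rw [Nat.div_zero]; omega
  · rw [Nat.div_zero]; omega

/-- Separation is MONOTONE in `η ≥ 1`: a larger `η` asks for smaller gaps. -/
theorem sepBlock_mono (y : Fin (n + 1) → (Fin n → Bool) → Bool) {a m η η' : ℕ} (hη : 0 < η) (hle : η ≤ η')
    (h : SepBlock y a m η) : SepBlock y a m η' := by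
  have hd : m / η' ≤ m / η := Nat.div_le_div_left hle hη
  refine ⟨fun g h1 h2 hl => ?_, fun g k h1 h2 h3 hl hk => ?_⟩
  · have h4 := h.1 g h1 h2 hl
    omega
  · have h4 := h.2 g k h1 h2 h3 hl hk
    omega

/-- On an `η`-separated block there are FEW inside live cuts: `j` of them need `(j+1)·(m/η) ≤ m`.  We record the case of two
cuts (used by the memo): two inside live cuts force `3·(m/η) ≤ m`, so an `η = 2`-separated block of length `m ≥ 2` has at most one
inside live cut. -/
theorem sepBlock_two_room (y : Fin (n + 1) → (Fin n → Bool) → Bool) {a m η : ℕ} (h : SepBlock y a m η)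
    {g k : Fin (n + 1)} (hg : a < g.val) (hk : k.val < a + m) (hgk : g.val < k.val) (hlg : Live y g) (hlk : Live y k) :
    3 * (m / η) ≤ m := by
  have h1 := h.1 g hg (by omega) hlg
  have h2 := h.1 k (by omega) hk hlk
  have h3 := h.2 g k hg hk hgk hlg hlk
  omega

end BlockVocab

section BlockPieces
variable (p : ℕ) [Fact p.Prime]

/-- **PIECE `BlockPiece p η`** (the analytic side of the dial): one `θ < 1` and a scale `C` such that every linear-test strategy with an
`η`-separated block of length `ℓ ≥ C·(log₂ n + 1)` wins on `≤ θ·2ⁿ` inputs.  [NECESSARY (`blockPiece_of_r5`) · ANTITONE in `η ≥ 1`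
(`blockPiece_anti`) · `η = 1`: `↔ WindowPiece p ↔ WindowHighRankLinSel p` (`p ≥ 5`) · `η = 0`: R5 itself up to the side condition
`C·(log₂ n+1) ≤ n` · split beneath by junta-rank in §30.] -/
def BlockPiece (η : ℕ) : Prop :=
  ∃ θ : ℝ, θ < 1 ∧ ∃ C : ℕ, ∃ n₀ : ℕ, ∀ L ℓ R : ℕ, n₀ ≤ L + ℓ + R → C * (Nat.log 2 (L + ℓ + R) + 1) ≤ ℓ →
    ∀ (c : ℕ) (y : Fin (L + ℓ + R + 1) → (Fin (L + ℓ + R) → Bool) → Bool), LinSel p y → SepBlock y L ℓ η →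
      ((univ.filter fun u : Fin (L + ℓ + R) → Bool => ringWinU c y u = true).card : ℝ) ≤ θ * (2 : ℝ) ^ (L + ℓ + R)

/-- **PIECE `ClusteredPiece p η`** (the combinatorial core of the dial): one `θ < 1` such that, for every scale `C` and all large `n`,
a linear-test strategy with NO `η`-separated block of length `≥ C·(log₂ n + 1)` wins on `≤ θ·2ⁿ` inputs.  [NECESSARY
(`clusteredPiece_of_r5`) · MONOTONE in `η ≥ 1` (`clusteredPiece_mono`): implied by the dense core for every `η ≥ 1` · `η = 1`:
`↔ NoWindowLinSel p` (`clusteredPiece_one_iff`) · IDEA-NEEDED: for `η ≥ 2` its strategies have, in EVERY long block, two live cuts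
closer than `m/η` (or one that close to any admissible block end).] -/
def ClusteredPiece (η : ℕ) : Prop :=
  ∃ θ : ℝ, θ < 1 ∧ ∀ C : ℕ, ∃ n₀ : ℕ, ∀ n ≥ n₀,
    ∀ (c : ℕ) (y : Fin (n + 1) → (Fin n → Bool) → Bool), LinSel p y →
      (∀ a m : ℕ, a + m ≤ n → C * (Nat.log 2 n + 1) ≤ m → ¬ SepBlock y a m η) →
      ((univ.filter fun u : Fin n → Bool => ringWinU c y u = true).card : ℝ) ≤ θ * (2 : ℝ) ^ n

/-- **The window piece of the tree in one `Prop`** (all long cut-free windows, no rank condition): `WindowRankLinSel p ∧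
WindowHighRankLinSel p` give it (`windowPiece_of_rank_pieces`), and it gives `WindowHighRankLinSel p` back. -/
def WindowPiece : Prop :=
  ∃ θ : ℝ, θ < 1 ∧ ∃ C : ℕ, ∃ n₀ : ℕ, ∀ L ℓ R : ℕ, n₀ ≤ L + ℓ + R → C * (Nat.log 2 (L + ℓ + R) + 1) ≤ ℓ →
    ∀ (c : ℕ) (y : Fin (L + ℓ + R + 1) → (Fin (L + ℓ + R) → Bool) → Bool), LinSel p y → CutFree y L ℓ →
      ((univ.filter fun u : Fin (L + ℓ + R) → Bool => ringWinU c y u = true).card : ℝ) ≤ θ * (2 : ℝ) ^ (L + ℓ + R)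

/-- **`R5 ⟸ BlockPiece p η ∧ ClusteredPiece p η`** (every `η`): either the strategy has a long `η`-separated block, or it has none. -/
theorem r5_of_block_pieces (η : ℕ) (hB : BlockPiece p η) (hC : ClusteredPiece p η) : WalkHardFLinSel p := by
  obtain ⟨θB, hθB, C, nB, hB⟩ := hB
  obtain ⟨θC, hθC, hC⟩ := hC
  obtain ⟨nC, hC⟩ := hC C
  refine ⟨max θB θC, max_lt hθB hθC, max nB nC, fun n hn c y hy => ?_⟩
  have hpos : (0 : ℝ) ≤ (2 : ℝ) ^ n := by positivity
  by_cases hw : ∃ a m : ℕ, a + m ≤ n ∧ C * (Nat.log 2 n + 1) ≤ m ∧ SepBlock y a m η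
  · obtain ⟨a, m, ham, hCm, hsep⟩ := hw
    obtain ⟨R', rfl⟩ : ∃ R', n = a + m + R' := ⟨n - (a + m), by omega⟩
    exact le_trans (hB a m R' (le_trans (le_max_left _ _) hn) hCm c y hy hsep)
      (mul_le_mul_of_nonneg_right (le_max_left _ _) hpos)
  · push Not at hw
    exact le_trans (hC n (le_trans (le_max_right _ _) hn) c y hy (fun a m ham hCm => hw a m ham hCm))
      (mul_le_mul_of_nonneg_right (le_max_right _ _) hpos)

/-- NECESSITY: R5 implies the block piece (every `η`). -/
theorem blockPiece_of_r5 (η : ℕ) (h : WalkHardFLinSel p) : BlockPiece p η := by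
  obtain ⟨θ, hθ, n₀, h⟩ := h
  exact ⟨θ, hθ, 0, n₀, fun L ℓ R hn _ c y hy _ => h (L + ℓ + R) hn c y hy⟩

/-- NECESSITY: R5 implies the clustered piece (every `η`). -/
theorem clusteredPiece_of_r5 (η : ℕ) (h : WalkHardFLinSel p) : ClusteredPiece p η := by
  obtain ⟨θ, hθ, n₀, h⟩ := h
  exact ⟨θ, hθ, fun _ => ⟨n₀, fun n hn c y hy _ => h n hn c y hy⟩⟩

/-- **rung R5 ⟺ the two block pieces**, at every notch `η` of the dial. -/
theorem r5_iff_block_pieces (η : ℕ) : WalkHardFLinSel p ↔ (BlockPiece p η ∧ ClusteredPiece p η) :=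
  ⟨fun h => ⟨blockPiece_of_r5 p η h, clusteredPiece_of_r5 p η h⟩, fun h => r5_of_block_pieces p η h.1 h.2⟩

/-- **The block piece is ANTITONE in `η ≥ 1`** (a larger `η` admits more blocks). -/
theorem blockPiece_anti {η η' : ℕ} (hη : 0 < η) (hle : η ≤ η') (h : BlockPiece p η') : BlockPiece p η := by
  obtain ⟨θ, hθ, C, n₀, h⟩ := h
  exact ⟨θ, hθ, C, n₀, fun L ℓ R hn hC c y hy hsep => h L ℓ R hn hC c y hy (sepBlock_mono y hη hle hsep)⟩

/-- **The clustered piece is MONOTONE in `η ≥ 1`** (a larger `η` leaves fewer strategies without a good block). -/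
theorem clusteredPiece_mono {η η' : ℕ} (hη : 0 < η) (hle : η ≤ η') (h : ClusteredPiece p η) : ClusteredPiece p η' := by
  obtain ⟨θ, hθ, h⟩ := h
  refine ⟨θ, hθ, fun C => ?_⟩
  obtain ⟨n₀, h⟩ := h C
  exact ⟨n₀, fun n hn c y hy hno => h n hn c y hy fun a m ham hCm hsep => hno a m ham hCm (sepBlock_mono y hη hle hsep)⟩

/-- **`η = 1` RECOVERY, analytic side**: `BlockPiece p 1 ↔ WindowPiece p`. -/
theorem blockPiece_one_iff : BlockPiece p 1 ↔ WindowPiece p := by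
  constructor
  · rintro ⟨θ, hθ, C, n₀, h⟩
    exact ⟨θ, hθ, C, n₀, fun L ℓ R hn hC c y hy hgap => h L ℓ R hn hC c y hy ((sepBlock_one_iff y L ℓ).mpr hgap)⟩
  · rintro ⟨θ, hθ, C, n₀, h⟩
    exact ⟨θ, hθ, C, n₀, fun L ℓ R hn hC c y hy hsep => h L ℓ R hn hC c y hy ((sepBlock_one_iff y L ℓ).mp hsep)⟩

/-- **`η = 1` RECOVERY, combinatorial side**: `ClusteredPiece p 1 ↔ NoWindowLinSel p` (the dense core of g24). -/
theorem clusteredPiece_one_iff : ClusteredPiece p 1 ↔ NoWindowLinSel p := by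
  constructor
  · rintro ⟨θ, hθ, h⟩
    refine ⟨θ, hθ, fun C => ?_⟩
    obtain ⟨n₀, h⟩ := h C
    exact ⟨n₀, fun n hn c y hy hno => h n hn c y hy fun a m ham hCm hsep => hno a m ham hCm ((sepBlock_one_iff y a m).mp hsep)⟩
  · rintro ⟨θ, hθ, h⟩
    refine ⟨θ, hθ, fun C => ?_⟩
    obtain ⟨n₀, h⟩ := h C
    exact ⟨n₀, fun n hn c y hy hno => h n hn c y hy fun a m ham hCm hgap => hno a m ham hCm ((sepBlock_one_iff y a m).mpr hgap)⟩

/-- The tree's two window pieces give the window piece (the window branch of `r5_of_rank_pieces`). -/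
theorem windowPiece_of_rank_pieces (hF : WindowRankLinSel p) (hD : WindowHighRankLinSel p) : WindowPiece p := by
  obtain ⟨E, hE, θF, hθF, ℓ₀, hF⟩ := hF
  obtain ⟨θD, hθD, CD, nD, hD⟩ := hD E hE
  refine ⟨max θF θD, max_lt hθF hθD, max CD ℓ₀, nD, fun L ℓ R hn hCm c y hy hcf => ?_⟩
  have hpos : (0 : ℝ) ≤ (2 : ℝ) ^ (L + ℓ + R) := by positivity
  have hlog : 1 ≤ Nat.log 2 (L + ℓ + R) + 1 := Nat.le_add_left 1 _
  have hℓ₀ : ℓ₀ ≤ ℓ := by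
    calc ℓ₀ ≤ max CD ℓ₀ := le_max_right _ _
      _ = max CD ℓ₀ * 1 := (mul_one _).symm
      _ ≤ max CD ℓ₀ * (Nat.log 2 (L + ℓ + R) + 1) := Nat.mul_le_mul_left _ hlog
      _ ≤ ℓ := hCm
  by_cases hr : RankLE p y (ℓ / E)
  · exact le_trans (hF L ℓ R hℓ₀ c y hy hcf hr) (mul_le_mul_of_nonneg_right (le_max_left _ _) hpos)
  · have hCD : CD * (Nat.log 2 (L + ℓ + R) + 1) ≤ ℓ := le_trans (Nat.mul_le_mul_right _ (le_max_left CD ℓ₀)) hCm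
    exact le_trans (hD L ℓ R hn hCD c y hy hcf hr) (mul_le_mul_of_nonneg_right (le_max_right _ _) hpos)

/-- Conversely the window piece gives the high-rank window piece (drop the rank hypothesis). -/
theorem windowHighRank_of_windowPiece (h : WindowPiece p) : WindowHighRankLinSel p := by
  obtain ⟨θ, hθ, C, n₀, h⟩ := h
  exact fun E _ => ⟨θ, hθ, C, n₀, fun L ℓ R hn hC c y hy hgap _ => h L ℓ R hn hC c y hy hgap⟩

/-- `WindowPiece p ↔ WindowHighRankLinSel p` for `p ≥ 5` (the low-rank piece is a theorem, `windowRankLinSel_holds`). -/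
theorem windowPiece_iff_highRank (hp : 5 ≤ p) : WindowPiece p ↔ WindowHighRankLinSel p :=
  ⟨windowHighRank_of_windowPiece p, windowPiece_of_rank_pieces p (windowRankLinSel_holds p hp)⟩

/-- `BlockPiece p 1 ↔ WindowHighRankLinSel p ↔ WindowJSpreadLinSel p s` (`p ≥ 5`, every width `s`). -/
theorem blockPiece_one_iff_jspread (hp : 5 ≤ p) (s : ℕ) : BlockPiece p 1 ↔ WindowJSpreadLinSel p s :=
  ((blockPiece_one_iff p).trans (windowPiece_iff_highRank p hp)).trans (highRank_iff_jspread p (by omega) s)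

/-- **The dial's notch `η = 1` IS the g26 residual**: `BlockPiece p 1 ∧ ClusteredPiece p 1 ↔ WindowJSpreadLinSel p s ∧ NoWindowLinSel p`. -/
theorem residual_one_iff (hp : 5 ≤ p) (s : ℕ) :
    (BlockPiece p 1 ∧ ClusteredPiece p 1) ↔ (WindowJSpreadLinSel p s ∧ NoWindowLinSel p) :=
  Iff.and (blockPiece_one_iff_jspread p hp s) (clusteredPiece_one_iff p)

/-- The clustered piece is implied by the dense core for every `η ≥ 1`. -/
theorem clusteredPiece_of_noWindow {η : ℕ} (hη : 1 ≤ η) (h : NoWindowLinSel p) : ClusteredPiece p η :=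
  clusteredPiece_mono p Nat.one_pos hη ((clusteredPiece_one_iff p).mpr h)

/-- The block piece gives the window piece for every `η ≥ 1`. -/
theorem windowPiece_of_blockPiece {η : ℕ} (hη : 1 ≤ η) (h : BlockPiece p η) : WindowPiece p :=
  (blockPiece_one_iff p).mp (blockPiece_anti p Nat.one_pos hη h)

end BlockPieces

end Summit.QuantumAdvantage.QuantumAdvantage.Theorems.RankDial
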